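import Summits.ResolutionOfSingularities.ResolutionOfSingularities.Theorems.FrobeniusLadderFInjectiveMacaulayficationGermOfGlobalBlowup
import HarnessLib

/-!
# GERM CERTIFICATES FROM BLOW-UP TOWERS: two- and three-step towers of blowings up, cosupported over `x` and FULL on top, certify `GermForm.FInjectivizationGermAt p x`
# (crux `FInjectiveMacaulayfication` stmt-ResolutionOfSingularities-15315, chain w45a; res-L1-w45a-stub-1 g9, (E2) «tower adapter» of the germ-instance interface
# p599230; res-L1-w45a-tri-2 #343 (a) «induct along any DP4 tower with T := {closed pt} ⇒ the tower IS `Bl_𝓚 (Spec 𝒪_x)`»; seat res-L1-w45a-stub-1 g9)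

[OURS · L1 W4.5a] Support file (`--supports stmt-ResolutionOfSingularities-15315 --as helper`); replaces the role of NO printed item; NOT a
statement of the manuscript; def-free, unconditional. AI-written (AI review is weaker than expert review).

## What is here
res-L1-w45a-idea-1's DP4 census FULL-ifies isolated double points by TOWERS of point- or stratum-cosupported blowings up (depth ≥ 2 for most rows; at `p = 2`
the F-blow-up towers `FB₁ ∘ FB₁` of res-L1-w45a-plan-1 03:25:24Z). A certificate for such a row is a chain `X ← X₁ ← X₂ (← X₃)` of GLOBAL blowings up whose
centres lie over `x` (among the generizations of `x`) with the top floor FULL over the generizations of `x`. This file turns such a chain into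
`GermForm.FInjectivizationGermAt p x`, by composing the tower into ONE blowing up of `X` cosupported over `x` (Stacks 080B with support control,
`IsBlowup.exists_isBlowup_comp_supported`, T := {y | y ⤳ x → y = x}) and applying the one-step bridge `GermOfGlobalBlowup.fInjectivizationGermAt_of_isBlowup_of_ne_bot`.

* `fInjectivizationGermAt_of_twoStep` — two floors; * `fInjectivizationGermAt_of_threeStep` — three floors;
* `exists_isBlowup_comp_over` — the composition step itself (a blow-up of a blow-up, both cosupported over `x`, is a blow-up cosupported over `x`), for longer
  towers by iteration.

[folklore; cite: StacksProject, Tag 080B (composition of blowings up); GortzWedhorn2020, Prop. 13.91 (2); Temkin2008, Lemma 2.1.4]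
-/

-- single-problem summit: the doubled namespace component is forced
set_option linter.dupNamespace false

noncomputable section

open AlgebraicGeometry CategoryTheory CategoryTheory.Limits Literature.AlgebraicGeometry.Resolution TopologicalSpace IsLocalRing

namespace Summit.ResolutionOfSingularities.ResolutionOfSingularities.Theorems.FInjectiveMacaulayfication.GermOfBlowupTower

open Summit.ResolutionOfSingularities.ResolutionOfSingularities.Theorems.FInjectiveMacaulayfication
open SliceableCentre GermForm GermOfGlobalBlowup

/-! ## §1 Composition with support control over `x` -/

/-- **A blowing up of a blowing up, both with centres lying over `x` (among the generizations of `x`), is ONE blowing up with centre lying over `x`.**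
Stacks 080B with `T := {y | y ⤳ x → y = x}`. [cite: StacksProject, Tag 080B] -/
theorem exists_isBlowup_comp_over {X X₁ X₂ : Scheme.{0}} [IsNoetherian X] (x : X)
    {π₁ : X₁ ⟶ X} {J₁ : X.IdealSheafData} (h₁ : IsBlowup π₁ J₁) (hsupp₁ : ∀ y ∈ (J₁.support : Set X), y ⤳ x → y = x)
    {π₂ : X₂ ⟶ X₁} {J₂ : X₁.IdealSheafData} (h₂ : IsBlowup π₂ J₂)
    (hsupp₂ : ∀ y ∈ (J₂.support : Set X₁), π₁.base y ⤳ x → π₁.base y = x) :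
    ∃ Q : X.IdealSheafData, IsBlowup (π₂ ≫ π₁) Q ∧ ∀ y ∈ (Q.support : Set X), y ⤳ x → y = x := by
  obtain ⟨Q, hQ, hQT⟩ := h₁.exists_isBlowup_comp_supported π₁ J₁ π₂ J₂ {y : X | y ⤳ x → y = x}
    (fun y hy => hsupp₁ y hy) h₂ (fun y hy => hsupp₂ y hy)
  exact ⟨Q, hQ, fun y hy => hQT hy⟩

/-! ## §2 Two floors -/

/-- **GERM CERTIFICATE FROM A TWO-STEP TOWER.** `X` integral Noetherian, `x ∈ X`; `π₁ : X₁ → X` a blowing up along `J₁ ≠ ⊥` with `supp J₁ ∩ gen(x) ⊆ {x}`;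
`π₂ : X₂ → X₁` a blowing up along `J₂ ≠ ⊥` whose support lies over `x` (among points over generizations of `x`); `X₂` FULL at every point over a generization of
`x`. Then `GermForm.FInjectivizationGermAt p x`. [folklore; cite: StacksProject, Tag 080B; GortzWedhorn2020, Prop. 13.91 (2)] -/
theorem fInjectivizationGermAt_of_twoStep (p : ℕ) {X X₁ X₂ : Scheme.{0}} [IsNoetherian X] [IsIntegral X] (x : X)
    {π₁ : X₁ ⟶ X} {J₁ : X.IdealSheafData} (h₁ : IsBlowup π₁ J₁) (hJ₁ : J₁ ≠ ⊥)
    (hsupp₁ : ∀ y ∈ (J₁.support : Set X), y ⤳ x → y = x)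
    {π₂ : X₂ ⟶ X₁} {J₂ : X₁.IdealSheafData} (h₂ : IsBlowup π₂ J₂) (hJ₂ : J₂ ≠ ⊥)
    (hsupp₂ : ∀ y ∈ (J₂.support : Set X₁), π₁.base y ⤳ x → π₁.base y = x)
    (hfull : ∀ x₂ : X₂, (π₂ ≫ π₁).base x₂ ⤳ x → FullCl p (X₂.presheaf.stalk x₂)) :
    FInjectivizationGermAt p x := by
  haveI : IsIntegral X₁ := h₁.isIntegral hJ₁
  haveI : IsIntegral X₂ := h₂.isIntegral hJ₂
  obtain ⟨Q, hQ, hQsupp⟩ := exists_isBlowup_comp_over x h₁ hsupp₁ h₂ hsupp₂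
  exact fInjectivizationGermAt_of_isBlowup_of_ne_bot p x hQ (RegularBlowupModelDim2.ne_bot_of_isBlowup hQ) hQsupp hfull

/-! ## §3 Three floors -/

/-- **GERM CERTIFICATE FROM A THREE-STEP TOWER** — as `fInjectivizationGermAt_of_twoStep` with a third blowing up `π₃ : X₃ → X₂` along `J₃ ≠ ⊥` lying over `x`,
`X₃` FULL over the generizations of `x`. (Longer towers: iterate `exists_isBlowup_comp_over`.) [folklore; cite: StacksProject, Tag 080B] -/
theorem fInjectivizationGermAt_of_threeStep (p : ℕ) {X X₁ X₂ X₃ : Scheme.{0}} [IsNoetherian X] [IsIntegral X] (x : X)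
    {π₁ : X₁ ⟶ X} {J₁ : X.IdealSheafData} (h₁ : IsBlowup π₁ J₁) (hJ₁ : J₁ ≠ ⊥)
    (hsupp₁ : ∀ y ∈ (J₁.support : Set X), y ⤳ x → y = x)
    {π₂ : X₂ ⟶ X₁} {J₂ : X₁.IdealSheafData} (h₂ : IsBlowup π₂ J₂) (hJ₂ : J₂ ≠ ⊥)
    (hsupp₂ : ∀ y ∈ (J₂.support : Set X₁), π₁.base y ⤳ x → π₁.base y = x)
    {π₃ : X₃ ⟶ X₂} {J₃ : X₂.IdealSheafData} (h₃ : IsBlowup π₃ J₃) (hJ₃ : J₃ ≠ ⊥)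
    (hsupp₃ : ∀ y ∈ (J₃.support : Set X₂), (π₂ ≫ π₁).base y ⤳ x → (π₂ ≫ π₁).base y = x)
    (hfull : ∀ x₃ : X₃, (π₃ ≫ π₂ ≫ π₁).base x₃ ⤳ x → FullCl p (X₃.presheaf.stalk x₃)) :
    FInjectivizationGermAt p x := by
  haveI : IsIntegral X₁ := h₁.isIntegral hJ₁
  haveI : IsIntegral X₂ := h₂.isIntegral hJ₂
  haveI : IsIntegral X₃ := h₃.isIntegral hJ₃
  -- compose the first two floors
  obtain ⟨Q, hQ, hQsupp⟩ := exists_isBlowup_comp_over x h₁ hsupp₁ h₂ hsupp₂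
  have hQne : Q ≠ ⊥ := RegularBlowupModelDim2.ne_bot_of_isBlowup hQ
  -- then the third
  have hfull' : ∀ x₃ : X₃, (π₃ ≫ (π₂ ≫ π₁)).base x₃ ⤳ x → FullCl p (X₃.presheaf.stalk x₃) := fun x₃ hx₃ =>
    hfull x₃ (by simpa only [Category.assoc] using hx₃)
  exact fInjectivizationGermAt_of_twoStep p x hQ hQne hQsupp h₃ hJ₃ hsupp₃ hfull'

end Summit.ResolutionOfSingularities.ResolutionOfSingularities.Theorems.FInjectiveMacaulayfication.GermOfBlowupTower

end
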